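import Summits.BirchSwinnertonDyer.Rank1Residual.Ordinary.StrictSelmerIndexRankOneRat
import Summits.BirchSwinnertonDyer.Rank1Residual.Ordinary.LocalDivExponentPointOrder
import HarnessLib

/-!
# On C-16's letter `#Sel_0(ℚ, E[3^∞]) = #Ш(E/ℚ)[3^∞]`: the strict-Selmer count at `m_p = 0`, in the letter's own
# currency (`¬ O5.PointLocallyThreeDivisibleAt`, Mathlib's `ℚ_[3]`) (theorems only — no definition, no named fact;
# nothing asserted about any curve's BSD; C-16 stays a CONJECTURE)

HONEST FRAMING (cell `b2b-bsdres`, run/shared/lean/b2b/bsd-rank1-residual/, verbatim in every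
file): the goal of the cell is to DELETE the COMBINATION-SHAPED residual classes of the
Birch–Swinnerton-Dyer formula for ALL analytic-rank `≤ 1` elliptic curves over `ℚ` — "full BSD
formula for every rank `≤ 1` curve in class `C`" assembled STRICTLY from published theorems — so
that the rank-`≤ 1` remainder becomes exactly the CONSTRUCTION-SHAPED classes, which are TYPED
(missing-input `Prop`s), NOT attempted. This is not "finishing BSD". Seat `b2b-bsdres-additive-p3`
(X8 prover B / X7 joint; typer-designate for the cell conjecture C-16 = hyp C120.1 by hyp R-16 (e)).
This file books nothing and moves no mark; X7 / X8 stay CONSTRUCTION-SHAPED.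

## What this file does

`Ordinary/StrictSelmerIndexRankOneRat.lean` proved `#Sel_0(ℚ, E[p^∞]) = p^m · #Ш(E/ℚ)[p^∞]` with `m` the `ℚ_v`-level of the
Mordell–Weil generator modulo torsion (`v ∋ p`; `v.adicCompletion ℚ` is the currency of the Selmer groups). C-16's letter
(`Ordinary/Conjectures/KuriharaExactOrderRankOneAt3.lean`) speaks Mathlib's `ℚ_[3]` (`¬ O5.PointLocallyThreeDivisibleAt W 3 P`).
This file bridges the currencies and reads the count on the letter:
* `exists_pointAddEquiv_adicCompletion_padic_comp` (`E(ℚ_v) ≃+ E(ℚ_p)` COMPATIBLY with the maps from `E(ℚ)`),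
  `exists_eq_pow_smul_add_torsion_adicCompletion_iff` (the level reads the same in both currencies),
  `exists_eq_nsmul_of_isOfFinAddOrder_of_forall` / `exists_eq_pow_smul_add_torsion_iff_of_forall` (without `p`-torsion
  «`∈ p^j G + tors`» = «`∈ p^j G`», the `m_p` of `LocalPointsModPrimePower`), `not_exists_eq_nsmul_add_torsion_adicCompletion`;
* **`natCard_strictSelmer_rat_eq_natCard_sha_of_not_divisible`** (`E(ℚ_p)[p] = 0`, `P₁ ↦ E(ℚ_p)` not `p • Q` ⟹
  `#Sel_0 = #Ш[p^∞]`) and **`natCard_strictSelmer_three_eq_natCard_sha_of_letter`**: on C-16's letter (`W` minimal, `3` good,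
  `a₃ ∉ {1, −2}` ⟹ `E(ℚ₃)[3] = 0` by the tree's `forall_three_nsmul_eq_zero_padic_of_frobeniusTrace_three`, `P` of infinite
  order generating modulo torsion, `¬ O5.PointLocallyThreeDivisibleAt W 3 P`) **`#Sel_0(ℚ, E[3^∞]) = #Ш(E/ℚ)[3^∞]`** — with
  Mazur–Rubin 5.2.12 (the named missing cohomological input) this is `∂⁰(κ) − ∂^∞(κ) = length Ш[3^∞]`, R1-DEPTH-LAW §2 (i) at
  `m₃ = 0`, now a theorem on its arithmetic side;
* `exists_level_padic` / `exists_level_adicCompletion` (the level EXISTS for every point of infinite order, AEC VII.6.3) ⟹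
  **`forall_exists_sub_kummerPruferHom_mem_rat` = Kim 2022 Lemma 5.1 over `ℚ`, UNCONDITIONAL** (for ANY `P₁` of infinite order,
  `Sel_{p^∞} = ` Kummer line of `P₁` ` + Sel_0`), general form `…_adicCompletion_of_cyclic`; `exists_natCard_strictSelmer_rat_eq_pow_mul`
  (`rank_ℤ = 1 ⟹ ∃ m, #Sel_0 = p^m·#Ш[p^∞]`), `finite_strictSelmer_iff_finite_sha_rat`, `padicValNat_natCard_strictSelmer_rat_eq`
  (`v_p #Sel_0 = m_p + v_p #Ш[p^∞]`), `natCard_strictSelmer_rat_eq_of_padic_level` (the level read on `E(ℚ_[p])`).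

References: C.-H. Kim, Amer. J. Math. = arXiv:2203.12159, §5.1 [Kim2022StructureSelmer]; B. Mazur, K. Rubin, Mem. AMS 799 (2004),
Thm 5.2.12 [MazurRubin2004]; J. H. Silverman, AEC 2nd ed. (2009), IV.6.1, VII.2.1, VII.6.3 [SilvermanAEC2009]; `R1-DEPTH-LAW.md` §2 (i).
-/

noncomputable section

open scoped Classical
open scoped AddSubgroup

open WeierstrassCurve Literature.NumberTheory.EllipticCurves
  Literature.NumberTheory.GaloisRepresentations

universe u

namespace Summit.BirchSwinnertonDyer.Rank1Residual.Ordinary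

section GeneralK

variable {K : Type u} [Field K] [NumberField K] (W : WeierstrassCurve K) [W.IsElliptic]
variable (p : ℕ) [hp : Fact p.Prime]

/-- **«`Sel_{p^∞} = (Kummer line) + Sel_0`» at a place `v` where `E(K_v)` is cyclic modulo `p` and torsion**, for
any `P₁` of finite `K_v`-divisibility level (general number field; the hypotheses `hLS`, `hm1` displayed).
[cite: Kim2022StructureSelmer, §5.1 Lemma 5.1] -/
theorem forall_exists_sub_kummerPruferHom_mem_adicCompletion_of_cyclic
    (v : IsDedekindDomain.HeightOneSpectrum (NumberField.RingOfIntegers K))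
    (hLS : ∃ Y : (W.baseChange (v.adicCompletion K)).toAffine.Point,
      ∀ X : (W.baseChange (v.adicCompletion K)).toAffine.Point,
        ∃ (c : ℕ) (Z T : (W.baseChange (v.adicCompletion K)).toAffine.Point),
          IsOfFinAddOrder T ∧ X = c • Y + p • Z + T)
    {P₁ : W.toAffine.Point} {m : ℕ}
    (hm1 : ¬ ∃ R T : (W.baseChange (v.adicCompletion K)).toAffine.Point, IsOfFinAddOrder T ∧
      Affine.Point.baseChange (W' := W) K (v.adicCompletion K) P₁ = p ^ (m + 1) • R + T) :
    ∀ c ∈ W.selmerGroupPInfty p, ∃ x : PruferQuot p,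
      c - kummerPruferHom W p W.zsmul_geomPoints_surjective_holds P₁ x ∈ selmerLocalKerPrimaryTorsion W (v.adicCompletion K) p := by
  haveI : CharZero (v.adicCompletion K) :=
    charZero_of_injective_algebraMap (algebraMap K (v.adicCompletion K)).injective
  haveI : PerfectField (v.adicCompletion K) := PerfectField.ofCharZero
  exact forall_exists_sub_kummerPruferHom_mem W p (v.adicCompletion K) hm1
    (selmerGroupPInfty_le_selmerLocalKerPrimary_adicCompletion W p v)
    (local_card_le_of_cyclic W p (v.adicCompletion K) hLS)

end GeneralK

section Letter

open Rat.HeightOneSpectrum NumberField IsDedekindDomain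

variable (W : WeierstrassCurve ℚ) [W.IsElliptic] {p : ℕ} [hp : Fact p.Prime]
  {v : HeightOneSpectrum (𝓞 ℚ)}

omit [W.IsElliptic] in
/-- **`E(ℚ_v) ≅ E(ℚ_p)` compatibly with the maps from `E(ℚ)`**: for the place `v ∋ p` of `ℚ` there is an
additive isomorphism `f : E(ℚ_v) ≃+ E(ℚ_p)` (transport along Mathlib's `padicEquiv v`) with
`f (P ↦ E(ℚ_v)) = (P ↦ E(ℚ_p))` for every `P ∈ E(ℚ)` (a `ℚ`-algebra map `ℚ → ℚ_p` is unique). [folklore] -/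
theorem exists_pointAddEquiv_adicCompletion_padic_comp (hpv : (p : 𝓞 ℚ) ∈ v.asIdeal) :
    ∃ f : (W.baseChange (v.adicCompletion ℚ)).toAffine.Point ≃+ (W.baseChange ℚ_[p]).toAffine.Point,
      ∀ P : W.toAffine.Point,
        f (Affine.Point.baseChange (W' := W) ℚ (v.adicCompletion ℚ) P) =
          Affine.Point.map (W' := W) (Algebra.ofId ℚ ℚ_[p]) P := by
  have hprim : ((primesEquiv v : Nat.Primes) : ℕ) = p := by
    have h : natGenerator v ∣ p := by
      rw [natGenerator_dvd_iff, ← map_natCast (Rat.IsIntegralClosure.intEquiv (𝓞 ℚ)) p]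
      exact Ideal.mem_map_of_mem _ hpv
    exact (Nat.prime_dvd_prime_iff_eq (prime_natGenerator v) hp.out).mp h
  obtain rfl := hprim
  let e : v.adicCompletion ℚ ≃ₐ[ℚ] ℚ_[(primesEquiv v : ℕ)] :=
    (adicCompletion.padicEquiv v).toAlgEquiv
  have hid : ∀ Q : (W.baseChange ℚ_[(primesEquiv v : ℕ)]).toAffine.Point,
      Affine.Point.map (AlgHom.id ℚ ℚ_[(primesEquiv v : ℕ)]) Q = Q := fun Q => by cases Q <;> rfl
  refine ⟨AddEquiv.ofBijective
    (Affine.Point.map (W' := W) (e : v.adicCompletion ℚ →ₐ[ℚ] ℚ_[(primesEquiv v : ℕ)]))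
    ⟨Affine.Point.map_injective (W' := W) _, fun Q ↦
      ⟨Affine.Point.map (W' := W) (e.symm : ℚ_[(primesEquiv v : ℕ)] →ₐ[ℚ] v.adicCompletion ℚ) Q,
        by rw [Affine.Point.map_map, AlgEquiv.comp_symm, hid]⟩⟩, fun P => ?_⟩
  change Affine.Point.map (W' := W) (e : v.adicCompletion ℚ →ₐ[ℚ] ℚ_[(primesEquiv v : ℕ)])
    (Affine.Point.map (W' := W) (Algebra.ofId ℚ (v.adicCompletion ℚ)) P) = _
  rw [Affine.Point.map_map, Algebra.comp_ofId]

omit hp in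
/-- In an additive commutative group without `p`-torsion, every torsion point is `p`-divisible
(its order `n` is prime to `p`, and `m • p • T = T` for `m p ≡ 1 (mod n)`). [folklore] -/
theorem exists_eq_nsmul_of_isOfFinAddOrder_of_forall {G : Type*} [AddCommGroup G] (hpp : p.Prime)
    (hG : ∀ X : G, p • X = 0 → X = 0) {T : G} (hT : IsOfFinAddOrder T) : ∃ S : G, T = p • S := by
  have hcop : p.Coprime (addOrderOf T) := by
    rw [Nat.Prime.coprime_iff_not_dvd hpp]
    intro hdvd
    obtain ⟨n, hn⟩ := hdvd
    have hn0 : n ≠ 0 := by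
      rintro rfl
      rw [mul_zero] at hn
      exact (addOrderOf_pos_iff.mpr hT).ne' hn
    have hlt : n < addOrderOf T := by
      rw [hn]
      exact lt_mul_left (Nat.pos_of_ne_zero hn0) hpp.one_lt
    have hy : n • T ≠ 0 := nsmul_ne_zero_of_lt_addOrderOf hn0 hlt
    apply hy
    apply hG
    rw [smul_smul, ← hn, addOrderOf_nsmul_eq_zero]
  obtain ⟨m, hm⟩ := exists_nsmul_eq_self_of_coprime hcop
  exact ⟨m • T, by rw [smul_comm, hm]⟩

omit [W.IsElliptic] in
/-- **The local divisibility level in the two currencies**: for `P₁ ∈ E(ℚ)` and any `k`,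
`P₁ ∈ p^k E(ℚ_v) + E(ℚ_v)_tors ⟺ P₁ ∈ p^k E(ℚ_p) + E(ℚ_p)_tors` (`v ∋ p`; transport along the compatible
`E(ℚ_v) ≃+ E(ℚ_p)`). So the `m` of the strict-Selmer count may be read on Mathlib's `ℚ_[p]`-points (the
currency of `Ordinary/LocalPointsModPrimePower.lean`'s `m_p`). [folklore] -/
theorem exists_eq_pow_smul_add_torsion_adicCompletion_iff (hpv : (p : 𝓞 ℚ) ∈ v.asIdeal)
    (P₁ : W.toAffine.Point) (k : ℕ) :
    (∃ R T : (W.baseChange (v.adicCompletion ℚ)).toAffine.Point, IsOfFinAddOrder T ∧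
        Affine.Point.baseChange (W' := W) ℚ (v.adicCompletion ℚ) P₁ = p ^ k • R + T) ↔
      ∃ R T : (W.baseChange ℚ_[p]).toAffine.Point, IsOfFinAddOrder T ∧
        Affine.Point.map (W' := W) (Algebra.ofId ℚ ℚ_[p]) P₁ = p ^ k • R + T := by
  obtain ⟨f, hf⟩ := exists_pointAddEquiv_adicCompletion_padic_comp W hpv
  constructor
  · rintro ⟨R, T, hT, h⟩
    refine ⟨f R, f T, f.toAddMonoidHom.isOfFinAddOrder hT, ?_⟩
    rw [← hf P₁, h, map_add, map_nsmul]
  · rintro ⟨R, T, hT, h⟩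
    refine ⟨f.symm R, f.symm T, f.symm.toAddMonoidHom.isOfFinAddOrder hT, ?_⟩
    apply f.injective
    rw [hf P₁, h, map_add, map_nsmul, AddEquiv.apply_symm_apply, AddEquiv.apply_symm_apply]

omit hp in
/-- Without `p`-torsion, **«`X ∈ p^j G + G_tors`» is «`X ∈ p^j G`»** (a torsion point of order prime to `p` is
`p^j`-divisible). So at a good non-anomalous odd `p` (`E(ℚ_p)[p] = 0`) the level `m` of the strict-Selmer count
is the `m_p` of `Ordinary/LocalPointsModPrimePower.lean` / `PointDivisibilityFormalLevel.lean` (`P ∈ p^j E(ℚ_p) ⟺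
#Ẽ(𝔽_p)·P ∈ E⁽ʲ⁺¹⁾`). [folklore] -/
theorem exists_eq_pow_smul_add_torsion_iff_of_forall {G : Type*} [AddCommGroup G] (hpp : p.Prime)
    (hG : ∀ X : G, p • X = 0 → X = 0) (X : G) (j : ℕ) :
    (∃ R T : G, IsOfFinAddOrder T ∧ X = p ^ j • R + T) ↔ ∃ R : G, X = p ^ j • R := by
  constructor
  · rintro ⟨R, T, hT, rfl⟩
    -- `T = p^j • S` by induction on `j`
    have key : ∀ i : ℕ, ∃ S : G, IsOfFinAddOrder S ∧ T = p ^ i • S := by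
      intro i
      induction i with
      | zero => exact ⟨T, hT, by rw [pow_zero, one_smul]⟩
      | succ i ih =>
        obtain ⟨S, hS, hTS⟩ := ih
        obtain ⟨S', hS'⟩ := exists_eq_nsmul_of_isOfFinAddOrder_of_forall hpp hG hS
        refine ⟨S', ?_, by rw [hTS, hS', smul_smul, ← pow_succ]⟩
        exact (hS'.symm ▸ hS : IsOfFinAddOrder (p • S')).of_nsmul hpp.ne_zero
    obtain ⟨S, -, hS⟩ := key j
    exact ⟨R + S, by rw [hS, smul_add]⟩
  · rintro ⟨R, rfl⟩
    exact ⟨R, 0, IsOfFinAddOrder.zero, by rw [add_zero]⟩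

omit [W.IsElliptic] in
/-- **`m_p(P₁) = 0` in the two currencies.** If `E(ℚ_p)` has no `p`-torsion and the image of `P₁` in
`E(ℚ_p)` (Mathlib's `ℚ_[p]`) is not `p • Q`, then the image of `P₁` in `E(ℚ_v)` (`v ∋ p`) is not in
`p E(ℚ_v) + E(ℚ_v)_tors` (the hypothesis `hm1` of the strict-Selmer count with `m = 0`). [folklore] -/
theorem not_exists_eq_nsmul_add_torsion_adicCompletion (hpv : (p : 𝓞 ℚ) ∈ v.asIdeal)
    (hloc : ∀ X : (W.baseChange ℚ_[p]).toAffine.Point, p • X = 0 → X = 0)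
    {P₁ : W.toAffine.Point}
    (hndiv : ¬ ∃ Q : (W.baseChange ℚ_[p]).toAffine.Point,
      Affine.Point.map (W' := W) (Algebra.ofId ℚ ℚ_[p]) P₁ = p • Q) :
    ¬ ∃ R T : (W.baseChange (v.adicCompletion ℚ)).toAffine.Point, IsOfFinAddOrder T ∧
      Affine.Point.baseChange (W' := W) ℚ (v.adicCompletion ℚ) P₁ = p ^ (0 + 1) • R + T := by
  rintro ⟨R, T, hT, h⟩
  obtain ⟨f, hf⟩ := exists_pointAddEquiv_adicCompletion_padic_comp W hpv
  obtain ⟨S, hS⟩ := exists_eq_nsmul_of_isOfFinAddOrder_of_forall hp.out hloc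
    (f.toAddMonoidHom.isOfFinAddOrder hT)
  have hS' : f T = p • S := hS
  refine hndiv ⟨f R + S, ?_⟩
  rw [← hf P₁, h, map_add, map_nsmul, zero_add, pow_one, hS', ← nsmul_add]

/-- **`#Sel_0(ℚ, E[p^∞]) = #Ш(E/ℚ)[p^∞]` when `m_p = 0`.** For `E/ℚ`, a prime `p` with `E(ℚ_p)[p] = 0`, and a
point `P₁` of infinite order generating `E(ℚ)` modulo torsion whose image in `E(ℚ_p)` is not divisible by `p`:
the `p`-strict Selmer group (at the place `v ∋ p`) and `Ш(E/ℚ)[p^∞]` have the same cardinality (`Nat.card`).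
[cite: Kim2022StructureSelmer, §5.1 eq. (5.1) and Lemma 5.1] -/
theorem natCard_strictSelmer_rat_eq_natCard_sha_of_not_divisible (hpv : (p : 𝓞 ℚ) ∈ v.asIdeal)
    (hloc : ∀ X : (W.baseChange ℚ_[p]).toAffine.Point, p • X = 0 → X = 0)
    {P₁ : W.toAffine.Point} (hP₁ : ¬ IsOfFinAddOrder P₁)
    (hgen : ∀ Q : W.toAffine.Point, ∃ n : ℤ, IsOfFinAddOrder (Q - n • P₁))
    (hndiv : ¬ ∃ Q : (W.baseChange ℚ_[p]).toAffine.Point,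
      Affine.Point.map (W' := W) (Algebra.ofId ℚ ℚ_[p]) P₁ = p • Q) :
    Nat.card ↥(W.selmerGroupPInfty p ⊓ selmerLocalKerPrimaryTorsion W (v.adicCompletion ℚ) p) =
      Nat.card (AddCommGroup.primaryComponent W.sha p) := by
  have hgen' : ∀ Q : W.toAffine.Point, ∃ (a : ℤ) (t : W.toAffine.Point),
      IsOfFinAddOrder t ∧ Q = a • P₁ + t := fun Q => by
    obtain ⟨n, hn⟩ := hgen Q
    exact ⟨n, Q - n • P₁, hn, by abel⟩
  have hm : ∃ R T : (W.baseChange (v.adicCompletion ℚ)).toAffine.Point, IsOfFinAddOrder T ∧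
      Affine.Point.baseChange (W' := W) ℚ (v.adicCompletion ℚ) P₁ = p ^ 0 • R + T :=
    ⟨_, 0, IsOfFinAddOrder.zero, by rw [pow_zero, one_smul, add_zero]⟩
  have h := natCard_strictSelmer_rat_eq W p hpv hP₁ hgen' hm
    (not_exists_eq_nsmul_add_torsion_adicCompletion W hpv hloc hndiv)
  rwa [pow_zero, one_mul] at h

/-- **On C-16's letter, `#Sel_0(ℚ, E[3^∞]) = #Ш(E/ℚ)[3^∞]`** (`m₃(P) = 0`): for `E/ℚ` globally minimal with
good reduction at `3`, `a₃ ∉ {1, −2}` (so `E(ℚ₃)[3] = 0`, tree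
`forall_three_nsmul_eq_zero_padic_of_frobeniusTrace_three`), `P` of infinite order generating `E(ℚ)` modulo
torsion and `¬ O5.PointLocallyThreeDivisibleAt W 3 P`: the `3`-strict Selmer group at the place `v ∋ 3` and
`Ш(E/ℚ)[3^∞]` have the same cardinality. With Mazur–Rubin 5.2.12 (NOT in the tree) this is
`∂⁰(κ^{Kato}) − ∂^∞(κ^{Kato}) = length Ш[3^∞]`, i.e. `a = FLOOR` with `m₃ = 0` in R1-DEPTH-LAW §2 (i) — the
arithmetic side of that step is now a theorem about the REAL `Sel_0`; nothing about BSD is asserted, C-16 stays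
a CONJECTURE. [cite: Kim2022StructureSelmer, §5.1 eq. (5.1) and Lemma 5.1] -/
theorem natCard_strictSelmer_three_eq_natCard_sha_of_letter [W.IsGloballyMinimal]
    (hv3 : ((3 : ℕ) : 𝓞 ℚ) ∈ v.asIdeal)
    (hgood : W.HasGoodReductionAtPrime 3) (ha1 : W.frobeniusTrace 3 ≠ 1) (ha2 : W.frobeniusTrace 3 ≠ -2)
    {P : W.toAffine.Point} (hP : ¬ IsOfFinAddOrder P)
    (hgen : ∀ Q : W.toAffine.Point, ∃ n : ℤ, IsOfFinAddOrder (Q - n • P))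
    (hndiv : ¬ O5.PointLocallyThreeDivisibleAt W 3 P) :
    haveI : Fact (Nat.Prime 3) := ⟨Nat.prime_three⟩
    Nat.card ↥(W.selmerGroupPInfty 3 ⊓ selmerLocalKerPrimaryTorsion W (v.adicCompletion ℚ) 3) =
      Nat.card (AddCommGroup.primaryComponent W.sha 3) := by
  haveI : Fact (Nat.Prime 3) := ⟨Nat.prime_three⟩
  exact natCard_strictSelmer_rat_eq_natCard_sha_of_not_divisible W hv3
    (forall_three_nsmul_eq_zero_padic_of_frobeniusTrace_three W hgood ha1 ha2) hP hgen hndiv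

/-! ### The local divisibility level EXISTS for a point of infinite order; Kim's Lemma 5.1 over `ℚ` -/

omit [W.IsElliptic] in
/-- Over Mathlib's `ℚ_[p]`: **a point of infinite order of `E(ℚ_p)` has a (unique) divisibility level modulo
torsion** — some `m` with `X ∈ p^m E(ℚ_p) + tors`, `X ∉ p^{m+1} E(ℚ_p) + tors` (the levels are bounded by the
valuation of `λ(X)` for `λ : E(ℚ_p) → ℤ_p` with kernel the torsion, AEC VII.6.3 — tree
`exists_addMonoidHom_padicInt_apply_eq_zero_iff`). [cite: SilvermanAEC2009, Prop. VII.6.3] -/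
theorem exists_level_padic (V : WeierstrassCurve ℚ_[p]) [V.IsElliptic] {X : V.toAffine.Point}
    (hX : ¬ IsOfFinAddOrder X) :
    ∃ m : ℕ, (∃ R T : V.toAffine.Point, IsOfFinAddOrder T ∧ X = p ^ m • R + T) ∧
      ¬ ∃ R T : V.toAffine.Point, IsOfFinAddOrder T ∧ X = p ^ (m + 1) • R + T := by
  obtain ⟨lam, hlam⟩ := exists_addMonoidHom_padicInt_apply_eq_zero_iff p V
  have hX0 : lam X ≠ 0 := fun h => hX ((hlam X).mp h)
  -- no level beyond the valuation of `λ(X)`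
  have hbound : ∀ k, (∃ R T : V.toAffine.Point, IsOfFinAddOrder T ∧ X = p ^ k • R + T) →
      k ≤ (lam X).valuation := by
    rintro k ⟨R, T, hT, h⟩
    have h1 : lam X = (p : ℤ_[p]) ^ k * lam R := by
      rw [h, map_add, map_nsmul, (hlam T).mpr hT, add_zero, nsmul_eq_mul, Nat.cast_pow]
    have hR0 : lam R ≠ 0 := by
      intro h0; rw [h1, h0, mul_zero] at hX0; exact hX0 rfl
    rw [h1, PadicInt.valuation_p_pow_mul k _ hR0]
    exact Nat.le_add_right k _
  have hex : ∃ k, ¬ ∃ R T : V.toAffine.Point, IsOfFinAddOrder T ∧ X = p ^ k • R + T :=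
    ⟨(lam X).valuation + 1, fun h => absurd (hbound _ h) (by omega)⟩
  set n₀ := Nat.find hex with hn₀def
  have hn₀ : ¬ ∃ R T : V.toAffine.Point, IsOfFinAddOrder T ∧ X = p ^ n₀ • R + T := Nat.find_spec hex
  have h0 : ∃ R T : V.toAffine.Point, IsOfFinAddOrder T ∧ X = p ^ 0 • R + T :=
    ⟨X, 0, IsOfFinAddOrder.zero, by rw [pow_zero, one_smul, add_zero]⟩
  have hpos : n₀ ≠ 0 := by
    intro h
    rw [h] at hn₀
    exact hn₀ h0
  refine ⟨n₀ - 1, ?_, by rw [Nat.sub_one_add_one hpos]; exact hn₀⟩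
  exact not_not.mp (Nat.find_min hex (Nat.sub_one_lt hpos))

/-- **The local divisibility level `m_p(P₁)` EXISTS** for a point `P₁ ∈ E(ℚ)` of infinite order, read in the
completion `E(ℚ_v)` (`v ∋ p`): some `m` satisfies the two hypotheses `hm`, `hm1` of the strict-Selmer count.
[cite: SilvermanAEC2009, Prop. VII.6.3] -/
theorem exists_level_adicCompletion (hpv : (p : 𝓞 ℚ) ∈ v.asIdeal) {P₁ : W.toAffine.Point}
    (hP₁ : ¬ IsOfFinAddOrder P₁) :
    ∃ m : ℕ,
      (∃ R T : (W.baseChange (v.adicCompletion ℚ)).toAffine.Point, IsOfFinAddOrder T ∧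
        Affine.Point.baseChange (W' := W) ℚ (v.adicCompletion ℚ) P₁ = p ^ m • R + T) ∧
      ¬ ∃ R T : (W.baseChange (v.adicCompletion ℚ)).toAffine.Point, IsOfFinAddOrder T ∧
        Affine.Point.baseChange (W' := W) ℚ (v.adicCompletion ℚ) P₁ = p ^ (m + 1) • R + T := by
  let j : W.toAffine.Point →+ (W.baseChange ℚ_[p]).toAffine.Point :=
    Affine.Point.map (W' := W) (Algebra.ofId ℚ ℚ_[p])
  have hj : Function.Injective j := Affine.Point.map_injective (W' := W) (Algebra.ofId ℚ ℚ_[p])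
  have hX : ¬ IsOfFinAddOrder (j P₁) := by
    intro h
    apply hP₁
    obtain ⟨n, hn, hnX⟩ := isOfFinAddOrder_iff_nsmul_eq_zero.mp h
    refine isOfFinAddOrder_iff_nsmul_eq_zero.mpr ⟨n, hn, hj ?_⟩
    rw [map_nsmul, hnX, map_zero]
  obtain ⟨m, hm, hm1⟩ := exists_level_padic (W.baseChange ℚ_[p]) hX
  exact ⟨m, (exists_eq_pow_smul_add_torsion_adicCompletion_iff W hpv P₁ m).mpr hm,
    fun h => hm1 ((exists_eq_pow_smul_add_torsion_adicCompletion_iff W hpv P₁ (m + 1)).mp h)⟩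

/-- **KIM's LEMMA 5.1 over `ℚ` in group form, UNCONDITIONAL: `Sel_{p^∞}(E/ℚ) = (Kummer line of P₁) + Sel_0`.**
For `E/ℚ`, any prime `p`, the place `v ∋ p` and ANY point `P₁ ∈ E(ℚ)` of infinite order (so `rank ≥ 1`): every
Selmer class is, up to a class `κ([a/p^N] ⊗ P₁)` of the Kummer line, locally trivial at `v`, i.e. the
localisation `Sel_{p^∞}(E/ℚ) → E(ℚ_p) ⊗ ℚ_p/ℤ_p` has the same image as the Kummer line of `P₁` (which is onto:
«if `rk E(ℚ) > 0` then `H¹_{/f}(ℚ_p,T) ∩ loc_p Sel_rel = H¹_{/f}(ℚ_p,T)`»). Inputs: `forall_exists_sub_kummerPruferHom_mem`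
+ `local_card_le_of_cyclic` + AEC VII.6.3. [cite: Kim2022StructureSelmer, §5.1 Lemma 5.1] -/
theorem forall_exists_sub_kummerPruferHom_mem_rat (hpv : (p : 𝓞 ℚ) ∈ v.asIdeal)
    {P₁ : W.toAffine.Point} (hP₁ : ¬ IsOfFinAddOrder P₁) :
    ∀ c ∈ W.selmerGroupPInfty p, ∃ x : PruferQuot p,
      c - kummerPruferHom W p W.zsmul_geomPoints_surjective_holds P₁ x ∈
        selmerLocalKerPrimaryTorsion W (v.adicCompletion ℚ) p := by
  obtain ⟨m, -, hm1⟩ := exists_level_adicCompletion W hpv hP₁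
  exact forall_exists_sub_kummerPruferHom_mem_adicCompletion_of_cyclic W p v
    (exists_generator_mod_p_add_torsion_adicCompletion W hpv) hm1

/-- **`∃ m_p, #Sel_0(ℚ, E[p^∞]) = p^{m_p} · #Ш(E/ℚ)[p^∞]`** for every `E/ℚ` of rank one and every prime `p` (the
level `m_p` of the Mordell–Weil generator exists and the count holds with it): `Sel_0` is finite iff `Ш[p^∞]`
is, and then `length Sel_0 = m_p + length Ш[p^∞]`. [cite: Kim2022StructureSelmer, §5.1 eq. (5.1) and Lemma 5.1] -/
theorem exists_natCard_strictSelmer_rat_eq_pow_mul (hpv : (p : 𝓞 ℚ) ∈ v.asIdeal)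
    (hrank : W.mordellWeilRank = 1) :
    ∃ m : ℕ, Nat.card ↥(W.selmerGroupPInfty p ⊓ selmerLocalKerPrimaryTorsion W (v.adicCompletion ℚ) p) =
      p ^ m * Nat.card (AddCommGroup.primaryComponent W.sha p) := by
  obtain ⟨P₁, hP₁, hgen, hcount⟩ := exists_generator_natCard_strictSelmer_rat_eq W p hpv hrank
  obtain ⟨m, hm, hm1⟩ := exists_level_adicCompletion W hpv hP₁
  exact ⟨m, hcount m hm hm1⟩

/-- **`Sel_0(ℚ, E[p^∞])` is finite iff `Ш(E/ℚ)[p^∞]` is** (rank one; from the count `#Sel_0 = p^m · #Ш[p^∞]` as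
`Nat.card`, both groups being non-empty). The tree's `finite_strictSelmer_of_mordellWeilRank_eq_one` is `⟸`.
[cite: Kim2022StructureSelmer, §5.1 eq. (5.1) and Lemma 5.1] -/
theorem finite_strictSelmer_iff_finite_sha_rat (hpv : (p : 𝓞 ℚ) ∈ v.asIdeal) (hrank : W.mordellWeilRank = 1) :
    Finite ↥(W.selmerGroupPInfty p ⊓ selmerLocalKerPrimaryTorsion W (v.adicCompletion ℚ) p) ↔
      Finite (AddCommGroup.primaryComponent W.sha p) := by
  obtain ⟨m, hm⟩ := exists_natCard_strictSelmer_rat_eq_pow_mul W hpv hrank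
  have hp0 : p ^ m ≠ 0 := pow_ne_zero m hp.out.ne_zero
  constructor
  · intro hfin
    have h : Nat.card ↥(W.selmerGroupPInfty p ⊓ selmerLocalKerPrimaryTorsion W (v.adicCompletion ℚ) p) ≠ 0 :=
      Nat.card_pos.ne'
    rw [hm] at h
    exact Nat.finite_of_card_ne_zero (right_ne_zero_of_mul h)
  · intro hfin
    have h : Nat.card (AddCommGroup.primaryComponent W.sha p) ≠ 0 := Nat.card_pos.ne'
    exact Nat.finite_of_card_ne_zero (by rw [hm]; exact mul_ne_zero hp0 h)

/-- **Length form: `v_p #Sel_0(ℚ, E[p^∞]) = m_p + v_p #Ш(E/ℚ)[p^∞]`** when `Ш[p^∞]` is finite (rank one, `m_p` the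
level of the Mordell–Weil generator) — the sentence «`length Sel_0 = m_p + length Ш`» of R1-DEPTH-LAW §2 (i)
verbatim. [cite: Kim2022StructureSelmer, §5.1 eq. (5.1) and Lemma 5.1] -/
theorem padicValNat_natCard_strictSelmer_rat_eq [DecidableEq ℚ] (hpv : (p : 𝓞 ℚ) ∈ v.asIdeal)
    {P₁ : W.toAffine.Point} (hP₁ : ¬ IsOfFinAddOrder P₁)
    (hgen : ∀ P : W.toAffine.Point, ∃ (a : ℤ) (t : W.toAffine.Point),
      IsOfFinAddOrder t ∧ P = a • P₁ + t) {m : ℕ}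
    (hm : ∃ R T : (W.baseChange (v.adicCompletion ℚ)).toAffine.Point, IsOfFinAddOrder T ∧
      Affine.Point.baseChange (W' := W) ℚ (v.adicCompletion ℚ) P₁ = p ^ m • R + T)
    (hm1 : ¬ ∃ R T : (W.baseChange (v.adicCompletion ℚ)).toAffine.Point, IsOfFinAddOrder T ∧
      Affine.Point.baseChange (W' := W) ℚ (v.adicCompletion ℚ) P₁ = p ^ (m + 1) • R + T)
    [Finite (AddCommGroup.primaryComponent W.sha p)] :
    padicValNat p (Nat.card ↥(W.selmerGroupPInfty p ⊓
        selmerLocalKerPrimaryTorsion W (v.adicCompletion ℚ) p)) =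
      m + padicValNat p (Nat.card (AddCommGroup.primaryComponent W.sha p)) := by
  rw [natCard_strictSelmer_rat_eq W p hpv hP₁ hgen hm hm1,
    padicValNat.mul (pow_ne_zero m hp.out.ne_zero) Nat.card_pos.ne', padicValNat.prime_pow]

/-- **The count with the level read on Mathlib's `E(ℚ_p)`**: for `E/ℚ`, `p`, `v ∋ p`, `P₁` of infinite order
generating modulo torsion, and `m` with `P₁ ∈ p^m E(ℚ_p) + tors`, `P₁ ∉ p^{m+1} E(ℚ_p) + tors` (points of
`W.baseChange ℚ_[p]`, the currency of `Ordinary/LocalPointsModPrimePower.lean`):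
`#Sel_0(ℚ, E[p^∞]) = p^m · #Ш(E/ℚ)[p^∞]`. [cite: Kim2022StructureSelmer, §5.1 eq. (5.1) and Lemma 5.1] -/
theorem natCard_strictSelmer_rat_eq_of_padic_level (hpv : (p : 𝓞 ℚ) ∈ v.asIdeal)
    {P₁ : W.toAffine.Point} (hP₁ : ¬ IsOfFinAddOrder P₁)
    (hgen : ∀ Q : W.toAffine.Point, ∃ n : ℤ, IsOfFinAddOrder (Q - n • P₁)) {m : ℕ}
    (hm : ∃ R T : (W.baseChange ℚ_[p]).toAffine.Point, IsOfFinAddOrder T ∧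
      Affine.Point.map (W' := W) (Algebra.ofId ℚ ℚ_[p]) P₁ = p ^ m • R + T)
    (hm1 : ¬ ∃ R T : (W.baseChange ℚ_[p]).toAffine.Point, IsOfFinAddOrder T ∧
      Affine.Point.map (W' := W) (Algebra.ofId ℚ ℚ_[p]) P₁ = p ^ (m + 1) • R + T) :
    Nat.card ↥(W.selmerGroupPInfty p ⊓ selmerLocalKerPrimaryTorsion W (v.adicCompletion ℚ) p) =
      p ^ m * Nat.card (AddCommGroup.primaryComponent W.sha p) := by
  have hgen' : ∀ Q : W.toAffine.Point, ∃ (a : ℤ) (t : W.toAffine.Point),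
      IsOfFinAddOrder t ∧ Q = a • P₁ + t := fun Q => by
    obtain ⟨n, hn⟩ := hgen Q
    exact ⟨n, Q - n • P₁, hn, by abel⟩
  exact natCard_strictSelmer_rat_eq W p hpv hP₁ hgen'
    ((exists_eq_pow_smul_add_torsion_adicCompletion_iff W hpv P₁ m).mpr hm)
    (fun h => hm1 ((exists_eq_pow_smul_add_torsion_adicCompletion_iff W hpv P₁ (m + 1)).mp h))

end Letter

end Summit.BirchSwinnertonDyer.Rank1Residual.Ordinary

end
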